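import Literature.AlgebraicGeometry.Morphisms.CechUnitCocycleSmallExtension
import HarnessLib

/-!
# The difference class of two unit cocycles with the same reduction along a small extension

`diffCochain` / `diffClass`: for two unit cocycles over `R` with THE SAME reduction over `R₀` (`SameRed`),
`u'_{ij} = u_{ij} (1 + kerMapA η_{ij})` for a unique `η ∈ (Č¹)^d` (`existsUnique_diff`); each `η_ℓ` is a Čech `1`-COCYCLE
of `𝒪_X` (`diffCochain_mem_cechZ1`), whence the DIFFERENCE CLASS `diffClass u u' ∈ Ȟ¹(𝒰, 𝒪_X)^d`; additive in chains
(`diffCochain_trans`, `diffClass_trans`, `_symm`, `_self`), ZERO IFF `u'` is obtained from `u` by a unit `0`-cochain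
reducing to `1` (`exists_rel_of_diffClass_eq_zero`, `diffClass_eq_zero_of_rel`); `exists_twist_sameRed` normalises a lift
whose reduction is only cohomologous to the reference — [GortzWedhorn2023] Lemma 26.15 in cocycle form.
HC_CM is proved only modulo the 7 printed citations until rung 0 closes.

## References
* [GortzWedhorn2023] U. Görtz, T. Wedhorn, *Algebraic Geometry II*, Lemma 26.15, Prop. 27.122 (`Lie(Pic_{X/S}) ≅ R¹f_*𝒪_X` via `U[ε]`).
* [MumfordAV1970] D. Mumford, *Abelian Varieties*, §13 (proof of the Thm. pp. 125–130).
* The Stacks Project, Tag 08SP (deformations of invertible modules), Tag 01ED (Čech cohomology).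
-/

noncomputable section

universe u v

open TensorProduct CategoryTheory AlgebraicGeometry
open Literature.RingTheory.Flat Literature.RingTheory.Flat.IsSmallExtension

namespace Literature.AlgebraicGeometry.Morphisms

namespace CechUnitCocycle

variable {A : Type u} [CommRing A] {X : Scheme.{u}} (f : X ⟶ Spec (.of A)) {ι : Type v} (U : ι → X.Opens)

/-! ## §4 The difference class of two lifts -/

section Diff

variable {f}
variable {R R₀ : Type u} [CommRing R] [CommRing R₀] [Algebra A R] [Algebra A R₀]
  {π : R →ₐ[A] R₀} {ρ : R →ₐ[A] A} {I : Ideal R} {d : ℕ} {e : (Fin d → A) ≃ₗ[A] I}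
  (H : IsSmallExtension π ρ I e) {ρ₀ : R₀ →ₐ[A] A} (hρ : ρ₀.comp π = ρ)

variable {U}

/-- Equal reductions of two cocycles along `π` (both reduce to the same cocycle over `R₀`: the
induction hypothesis over a small extension `R → R₀`).
[cite: GortzWedhorn2023, Lemma 24.72 (p. 409), proof, Step (I) (p. 410)] -/
def SameRed (u u' : UCocycle f U R) (π : R →ₐ[A] R₀) : Prop := ∀ i j, coef f π _ (u'.val i j) = coef f π _ (u.val i j)

/-- `SameRed` is reflexive. [cite: GortzWedhorn2023, Lemma 26.15] -/
theorem SameRed.refl (u : UCocycle f U R) : SameRed u u π := fun _ _ => rfl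
/-- `SameRed` is symmetric. [cite: GortzWedhorn2023, Lemma 26.15] -/
theorem SameRed.symm {u u' : UCocycle f U R} (h : SameRed u u' π) : SameRed u' u π := fun i j => (h i j).symm
/-- `SameRed` is transitive. [cite: GortzWedhorn2023, Lemma 26.15] -/
theorem SameRed.trans {u u' u'' : UCocycle f U R} (h : SameRed u u' π) (h' : SameRed u' u'' π) : SameRed u u'' π :=
  fun i j => (h' i j).trans (h i j)
/-- `SameRed u u'` iff the reductions are equal as cocycles. [cite: GortzWedhorn2023, Lemma 26.15] -/
theorem sameRed_iff_map (u u' : UCocycle f U R) : SameRed u u' π ↔ ∀ i j, (u'.map π).val i j = (u.map π).val i j :=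
  Iff.rfl

variable [∀ V : X.Opens, Module.Flat A (Sections f V)]

include H

/-- **Two units with the same reduction differ by `1 + κ y` for a unique `y`.** [cite: GortzWedhorn2023, Lemma 26.15] -/
theorem existsUnique_diff {V : X.Opens} {x x' : Sections f V ⊗[A] R} (hx : IsUnit x)
    (hred : coef f π V x' = coef f π V x) : ∃! y : Fin d → Sections f V, x' = x * (1 + kerMapA f e V y) := by
  set xi : Sections f V ⊗[A] R := ↑hx.unit⁻¹ with hxi
  have hxi1 : xi * x = 1 := hx.val_inv_mul
  have hxi2 : x * xi = 1 := hx.mul_val_inv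
  obtain ⟨y, hy⟩ := exists_kerMapA_eq H (V := V) (x := xi * x' - 1) (by
    rw [map_sub, map_mul, hred, ← map_mul, hxi1, map_one, sub_self])
  have key : x' = x * (1 + (xi * x' - 1)) := by
    rw [add_sub_cancel, ← mul_assoc, hxi2, one_mul]
  refine ⟨y, ?_, fun y' hy' => ?_⟩
  · show x' = x * (1 + kerMapA f e V y)
    rw [hy]; exact key
  have hy'' : x' = x * (1 + kerMapA f e V y') := hy'
  refine kerMapA_injective (e := e) V ?_
  have h1 : x * (1 + kerMapA f e V y') = x * (1 + kerMapA f e V y) := by rw [← hy'', hy]; exact key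
  exact add_left_cancel ((hx.mul_right_inj).1 h1)

/-- The difference vector `y` with `x' = x (1 + κ y)`. [cite: GortzWedhorn2023, Lemma 26.15] -/
def diff {V : X.Opens} {x x' : Sections f V ⊗[A] R} (hx : IsUnit x) (hred : coef f π V x' = coef f π V x) :
    Fin d → Sections f V :=
  (existsUnique_diff H hx hred).choose

/-- Defining property of `diff`. [cite: GortzWedhorn2023, Lemma 26.15] -/
theorem diff_spec {V : X.Opens} {x x' : Sections f V ⊗[A] R} (hx : IsUnit x) (hred : coef f π V x' = coef f π V x) :
    x' = x * (1 + kerMapA f e V (diff H hx hred)) :=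
  (existsUnique_diff H hx hred).choose_spec.1

/-- Characterisation of `diff`. [cite: GortzWedhorn2023, Lemma 26.15] -/
theorem diff_eq_iff {V : X.Opens} {x x' : Sections f V ⊗[A] R} (hx : IsUnit x) (hred : coef f π V x' = coef f π V x)
    (y : Fin d → Sections f V) : diff H hx hred = y ↔ x' = x * (1 + kerMapA f e V y) :=
  ⟨fun h => h ▸ diff_spec H hx hred, fun h => ((existsUnique_diff H hx hred).unique (diff_spec H hx hred) h)⟩

/-- **The difference cochain** `η ∈ (Č¹(𝒰, 𝒪_X))^d` of two unit cocycles with the same reduction: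
`u'_{ij} = u_{ij} (1 + κ η_{ij})`. [cite: GortzWedhorn2023, Lemma 26.15] -/
def diffCochain (u u' : UCocycle f U R) (hred : SameRed u u' π) : Fin d → CechC1 f U :=
  fun ℓ i j => diff H (u.isUnit i j) (hred i j) ℓ

/-- Defining property of the difference cochain. [cite: GortzWedhorn2023, Lemma 26.15] -/
theorem diffCochain_spec (u u' : UCocycle f U R) (hred : SameRed u u' π) (i j : ι) :
    u'.val i j = u.val i j * (1 + kerMapA f e _ (fun ℓ => diffCochain H u u' hred ℓ i j)) :=
  diff_spec H (u.isUnit i j) (hred i j)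

/-- Uniqueness form of the difference cochain. [cite: GortzWedhorn2023, Lemma 26.15] -/
theorem diffCochain_eq_iff (u u' : UCocycle f U R) (hred : SameRed u u' π) (η : Fin d → CechC1 f U) :
    diffCochain H u u' hred = η ↔ ∀ i j, u'.val i j = u.val i j * (1 + kerMapA f e _ (fun ℓ => η ℓ i j)) := by
  constructor
  · rintro rfl i j; exact diffCochain_spec H u u' hred i j
  · intro h; funext ℓ i j
    have := (diff_eq_iff H (u.isUnit i j) (hred i j) (fun ℓ => η ℓ i j)).2 (h i j)
    exact congrFun this ℓ

include hρ

/-- **The difference cochain is a `d`-tuple of Čech `1`-COCYCLES of `𝒪_X`.** [cite: GortzWedhorn2023, Lemma 26.15] -/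
theorem diffCochain_mem_cechZ1 (u u' : UCocycle f U R) (hred : SameRed u u' π) (ℓ : Fin d) :
    diffCochain H u u' hred ℓ ∈ cechZ1 f U := by
  rw [mem_cechZ1_iff]
  funext i j k
  set η := diffCochain H u u' hred with hη
  -- restrict the defining relations to `U_{ijk}`
  have e12 := congrArg (resR f R (le12 i j k)) (diffCochain_spec H u u' hred i j)
  have e23 := congrArg (resR f R (le23 i j k)) (diffCochain_spec H u u' hred j k)
  have e13 := congrArg (resR f R (le13 i j k)) (diffCochain_spec H u u' hred i k)
  simp only [map_mul, map_add, map_one, resR_kerMapA] at e12 e23 e13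
  -- multiply: `u'_{ij}| u'_{jk}| = u'_{ik}|`
  have hc' := u'.cocycle i j k
  rw [e12, e23, e13] at hc'
  have hu13 : IsUnit (resR f R (le13 i j k) (u.val i k)) := (u.isUnit i k).map _
  rw [mul_mul_mul_comm, u.cocycle, one_add_mul_one_add H hρ] at hc'
  have h2 := add_left_cancel ((hu13.mul_right_inj).1 hc')
  have h3 := congrFun (kerMapA_injective (e := e) _ h2) ℓ
  simp only [Pi.add_apply] at h3
  -- `cechD1 η_ℓ = η_jk| - η_ik| + η_ij|`
  rw [cechD1_apply, Pi.zero_apply]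
  change Sections.res f (le23 i j k) (η ℓ j k) - Sections.res f (le13 i j k) (η ℓ i k) +
    Sections.res f (le12 i j k) (η ℓ i j) = 0
  rw [← h3]; ring

/-- **The difference class** `diffClass u u' ∈ Ȟ¹(𝒰, 𝒪_X)^d`. [cite: GortzWedhorn2023, Lemma 26.15] -/
def diffClass (u u' : UCocycle f U R) (hred : SameRed u u' π) : Fin d → CechH1 f U :=
  fun ℓ => CechH1.mk f U ⟨diffCochain H u u' hred ℓ, diffCochain_mem_cechZ1 H hρ u u' hred ℓ⟩

omit hρ in
/-- `diffCochain u u = 0`. [cite: GortzWedhorn2023, Lemma 26.15] -/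
theorem diffCochain_self (u : UCocycle f U R) : diffCochain H u u (SameRed.refl u) = 0 :=
  (diffCochain_eq_iff H u u _ 0).2 fun i j => by
    change u.val i j = u.val i j * (1 + kerMapA f e _ (0 : Fin d → _)); rw [kerMapA_zero]; ring

/-- **Additivity in chains**: `η(u, u'') = η(u, u') + η(u', u'')`. [cite: GortzWedhorn2023, Lemma 26.15] -/
theorem diffCochain_trans (u u' u'' : UCocycle f U R) (h : SameRed u u' π) (h' : SameRed u' u'' π) :
    diffCochain H u u'' (h.trans h') = diffCochain H u u' h + diffCochain H u' u'' h' := by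
  refine (diffCochain_eq_iff H u u'' _ _).2 fun i j => ?_
  rw [diffCochain_spec H u' u'' h' i j, diffCochain_spec H u u' h i j, mul_assoc, one_add_mul_one_add H hρ]
  rfl

/-- Antisymmetry: `η(u', u) = −η(u, u')`. [cite: GortzWedhorn2023, Lemma 26.15] -/
theorem diffCochain_symm (u u' : UCocycle f U R) (h : SameRed u u' π) :
    diffCochain H u' u h.symm = -diffCochain H u u' h := by
  have := diffCochain_trans H hρ u u' u h h.symm
  rw [diffCochain_self] at this
  exact (neg_eq_of_add_eq_zero_right this.symm).symm

/-- `diffClass u u = 0`. [cite: GortzWedhorn2023, Lemma 26.15] -/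
theorem diffClass_self (u : UCocycle f U R) (ℓ : Fin d) : diffClass H hρ u u (SameRed.refl u) ℓ = 0 := by
  simp only [diffClass, diffCochain_self H]
  exact map_zero _

/-- Additivity of the difference class. [cite: GortzWedhorn2023, Lemma 26.15] -/
theorem diffClass_trans (u u' u'' : UCocycle f U R) (h : SameRed u u' π) (h' : SameRed u' u'' π) (ℓ : Fin d) :
    diffClass H hρ u u'' (h.trans h') ℓ = diffClass H hρ u u' h ℓ + diffClass H hρ u' u'' h' ℓ := by
  simp only [diffClass, ← map_add]
  congr 1
  apply Subtype.ext
  simp only [Submodule.coe_add, diffCochain_trans H hρ u u' u'' h h', Pi.add_apply]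

/-- Antisymmetry of the difference class. [cite: GortzWedhorn2023, Lemma 26.15] -/
theorem diffClass_symm (u u' : UCocycle f U R) (h : SameRed u u' π) (ℓ : Fin d) :
    diffClass H hρ u' u h.symm ℓ = -diffClass H hρ u u' h ℓ := by
  simp only [diffClass, ← map_neg]
  congr 1; apply Subtype.ext
  simp [diffCochain_symm H hρ u u' h]

/-- Proof-irrelevance of `diffClass` in the `SameRed` witness. [cite: GortzWedhorn2023, Lemma 26.15] -/
theorem diffClass_irrel (u u' : UCocycle f U R) (h h' : SameRed u u' π) (ℓ : Fin d) :
    diffClass H hρ u u' h ℓ = diffClass H hρ u u' h' ℓ := rfl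

/-- **Vanishing of the difference class ⟹ the cocycles are related by a unit `0`-cochain reducing to `1`.**
[cite: GortzWedhorn2023, Lemma 26.15] -/
theorem exists_rel_of_diffClass_eq_zero (u u' : UCocycle f U R) (hred : SameRed u u' π)
    (h0 : ∀ ℓ, diffClass H hρ u u' hred ℓ = 0) :
    ∃ h : UCochain0 f U R, (∀ i, coef f π (U i) (h i : Sections f (U i) ⊗[A] R) = 1) ∧
      Rel u u' (fun i => (h i : Sections f (U i) ⊗[A] R)) := by
  -- `η_ℓ = d⁰ β_ℓ`
  have hB : ∀ ℓ, ∃ β : CechC0 f U, cechD0 f U β = diffCochain H u u' hred ℓ := fun ℓ => by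
    have h1 := (CechH1.mk_eq_zero_iff f U _).1 (h0 ℓ)
    exact (mem_cechB1_iff f U _).1 h1
  choose β hβ using hB
  -- `h_i := 1 − κ(β_·(i))`
  refine ⟨fun i => (isUnit_one_add H hρ (U i) (fun ℓ => -β ℓ i)).unit, fun i => by
    rw [IsUnit.unit_spec, map_add, map_one, coef_kerMapA H, add_zero], fun i j => ?_⟩
  simp only [IsUnit.unit_spec]
  rw [diffCochain_spec H u u' hred i j]
  simp only [map_add, map_one, resR_kerMapA, map_neg]
  have hη : (fun ℓ => diffCochain H u u' hred ℓ i j) =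
      fun ℓ => Sections.res f (inf_le_right : U i ⊓ U j ≤ U j) (β ℓ j) -
        Sections.res f (inf_le_left : U i ⊓ U j ≤ U i) (β ℓ i) := by
    funext ℓ; rw [← hβ ℓ, cechD0_apply]
  rw [hη, mul_assoc, one_add_mul_one_add H hρ, mul_comm]
  congr 3; funext ℓ; simp only [Pi.add_apply]; ring

omit H hρ [∀ V : X.Opens, Module.Flat A (Sections f V)] in
/-- **Conversely**, cocycles related by a `0`-cochain reducing to `1` have the same reduction … [cite: GortzWedhorn2023, Lemma 26.15] -/
theorem sameRed_of_rel (u u' : UCocycle f U R) (h : (i : ι) → Sections f (U i) ⊗[A] R)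
    (h1 : ∀ i, coef f π _ (h i) = 1) (hr : Rel u u' h) : SameRed u u' π := fun i j => by
  have := congrArg (coef f π _) (hr i j)
  simp only [map_mul, ← resR_coef, h1, map_one, one_mul, mul_one] at this
  exact this.symm

/-- … and ZERO difference class. [cite: GortzWedhorn2023, Lemma 26.15] -/
theorem diffClass_eq_zero_of_rel (u u' : UCocycle f U R) (h : (i : ι) → Sections f (U i) ⊗[A] R)
    (h1 : ∀ i, coef f π _ (h i) = 1) (hr : Rel u u' h) (ℓ : Fin d) :
    diffClass H hρ u u' (sameRed_of_rel u u' h h1 hr) ℓ = 0 := by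
  -- `h_i = 1 + κ b_i`
  have hb : ∀ i, ∃ b : Fin d → Sections f (U i), h i = 1 + kerMapA f e _ b := fun i => exists_eq_one_add H (h1 i)
  choose b hb using hb
  have hred : SameRed u u' π := sameRed_of_rel u u' h h1 hr
  -- the difference cochain is `b_i| − b_j|`, a coboundary
  have hη : diffCochain H u u' hred = fun ℓ i j =>
      Sections.res f (inf_le_left : U i ⊓ U j ≤ U i) (b i ℓ) - Sections.res f (inf_le_right : U i ⊓ U j ≤ U j) (b j ℓ) := by
    refine (diffCochain_eq_iff H u u' hred _).2 fun i j => ?_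
    have hij := hr i j
    rw [hb i, hb j] at hij
    simp only [map_add, map_one, resR_kerMapA] at hij
    set bi : Fin d → Sections f (U i ⊓ U j) := fun ℓ => Sections.res f (inf_le_left : U i ⊓ U j ≤ U i) (b i ℓ)
    set bj : Fin d → Sections f (U i ⊓ U j) := fun ℓ => Sections.res f (inf_le_right : U i ⊓ U j ≤ U j) (b j ℓ)
    have hinv : (1 + kerMapA f e _ bj) * (1 + kerMapA f e _ (-bj)) = 1 := by
      rw [one_add_mul_one_add H hρ, add_neg_cancel, kerMapA_zero, add_zero]
    have hgoal : (fun ℓ => Sections.res f (inf_le_left : U i ⊓ U j ≤ U i) (b i ℓ) -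
        Sections.res f (inf_le_right : U i ⊓ U j ≤ U j) (b j ℓ)) = bi + -bj := by
      funext ℓ; simp [bi, bj, sub_eq_add_neg]
    rw [hgoal]
    calc u'.val i j = u'.val i j * ((1 + kerMapA f e _ bj) * (1 + kerMapA f e _ (-bj))) := by rw [hinv, mul_one]
      _ = ((1 + kerMapA f e _ bi) * u.val i j) * (1 + kerMapA f e _ (-bj)) := by rw [← mul_assoc, ← hij]
      _ = u.val i j * ((1 + kerMapA f e _ bi) * (1 + kerMapA f e _ (-bj))) := by ring
      _ = u.val i j * (1 + kerMapA f e _ (bi + -bj)) := by rw [one_add_mul_one_add H hρ]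
  simp only [diffClass]
  apply (CechH1.mk_eq_zero_iff f U _).2
  refine (mem_cechB1_iff f U _).2 ⟨fun i => -b i ℓ, ?_⟩
  funext i j
  rw [cechD0_apply]
  change _ = diffCochain H u u' hred ℓ i j
  rw [hη]; simp only [map_neg]; ring

omit hρ [∀ V : X.Opens, Module.Flat A (Sections f V)] in
/-- **NORMALISATION OF A LIFT**: if the reduction of `w` is related to the reduction of `u` by a unit `0`-cochain
`h₀` over `R₀` (`h₀_i w̄ = ū h₀_j`), then the twist of `w` by any lift of `h₀` has THE SAME reduction as `u`.
[cite: GortzWedhorn2023, Lemma 26.15] -/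
theorem exists_twist_sameRed (hρ : ρ₀.comp π = ρ) (u w : UCocycle f U R) (h₀ : UCochain0 f U R₀)
    (hr : Rel (w.map π) (u.map π) (fun i => ↑(h₀ i))) :
    ∃ h : UCochain0 f U R, (∀ i, coef f π (U i) (h i : Sections f (U i) ⊗[A] R) = ↑(h₀ i)) ∧
      SameRed u (w.twist h) π := by
  -- lift `h₀` along the surjection `id ⊗ π`
  have hl : ∀ i, ∃ x : Sections f (U i) ⊗[A] R, coef f π _ x = ↑(h₀ i) := fun i =>
    H.mapπ_surjective (Sections f (U i)) _
  choose x hx using hl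
  have hxu : ∀ i, IsUnit (x i) := fun i =>
    isUnit_of_coef H (by rw [hx i]; exact (h₀ i).isUnit) hρ
  refine ⟨fun i => (hxu i).unit, fun i => by rw [IsUnit.unit_spec, hx i], fun i j => ?_⟩
  -- reduce `h_i| w h_j|⁻¹` and use `h₀_i w̄ = ū h₀_j`
  have hinv : ∀ i, coef f π (U i) ((hxu i).unit⁻¹ : (Sections f (U i) ⊗[A] R)ˣ) =
      (((h₀ i)⁻¹ : (Sections f (U i) ⊗[A] R₀)ˣ) : Sections f (U i) ⊗[A] R₀) := fun i => by
    have h1 : coef f π (U i) ((hxu i).unit⁻¹ : (Sections f (U i) ⊗[A] R)ˣ) * (h₀ i : Sections f (U i) ⊗[A] R₀) = 1 := by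
      rw [← hx i, ← map_mul, IsUnit.val_inv_mul, map_one]
    calc coef f π (U i) ((hxu i).unit⁻¹ : (Sections f (U i) ⊗[A] R)ˣ)
        = coef f π (U i) ((hxu i).unit⁻¹ : (Sections f (U i) ⊗[A] R)ˣ) *
            ((h₀ i : Sections f (U i) ⊗[A] R₀) * (((h₀ i)⁻¹ : (Sections f (U i) ⊗[A] R₀)ˣ) : Sections f (U i) ⊗[A] R₀)) := by
          rw [Units.mul_inv, mul_one]
      _ = (((h₀ i)⁻¹ : (Sections f (U i) ⊗[A] R₀)ˣ) : Sections f (U i) ⊗[A] R₀) := by rw [← mul_assoc, h1, one_mul]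
  rw [UCocycle.twist_val, map_mul, map_mul, ← resR_coef, ← resR_coef, IsUnit.unit_spec, hx i, hinv j]
  have hij := hr i j
  simp only [UCocycle.map_val] at hij
  -- `h₀_i| w̄ = ū h₀_j|` ⇒ `h₀_i| w̄ h₀_j|⁻¹ = ū`
  calc resR f R₀ inf_le_left ↑(h₀ i) * coef f π _ (w.val i j) * resR f R₀ inf_le_right ↑(h₀ j)⁻¹
      = coef f π _ (u.val i j) * (resR f R₀ (inf_le_right : U i ⊓ U j ≤ U j) ↑(h₀ j) *
          resR f R₀ inf_le_right ↑(h₀ j)⁻¹) := by rw [hij, mul_assoc]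
    _ = coef f π _ (u.val i j) := by rw [UCocycle.res_mul_inv, mul_one]

end Diff

end CechUnitCocycle

end Literature.AlgebraicGeometry.Morphisms

end
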